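import Literature.Probability.RandomPlanarGeometry.SLERestrictionIncrement
import HarnessLib

/-!
# Boundary-cell estimates for the localised restriction martingale ([LSW] §5)

Auxiliary estimates for the cells of a partition containing the localising time `Tₙ`
(`SLERestrictionProcesses.locTime`), used to show that the stopped process
`t ↦ (D̂ⁿ⁺¹_{t ∧ Tₙ})^{5/8} = Φ'_{A_{t∧Tₙ} - W_{t∧Tₙ}}(0)^{5/8}` is a martingale:

* `controlled_of_le_locTime` — the controlled-class bounds persist up to and including `Tₙ`
  (continuity of `R` and `D̂`);
* `abs_rpow_sub_rpow_le` — `|x^{5/8} - y^{5/8}| ≤ |x - y|^{5/8}`;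
* `abs_stopped_sub_DFn_rpow_le` — in a cell `[u, u+h]` with `u < Tₙ`, if the driver oscillates by
  at most `S` on `[u, u+h]` and `h`, `S` are small, then `|Ỹ_{(u+h) ∧ Tₙ} - Ŷ_{u+h}| ≤ (2Δ)^{5/8}`,
  `Δ = 50h/ρ₀² + 2(S + 4√h)/ρ₀` (one-step derivative bounds from the base time `u`,
  `abs_starDeriv_slidHull_sub_le`; survival `SLERestrictionStepAlive`), and it vanishes when
  `Tₙ ≥ u + h`;
* `oscFn` — the dyadic running supremum of `|υ(r) - υ(0)|`, `r ≤ h`, as a measurable functional on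
  `C(ℝ≥0, ℝ)` dominating the oscillation (`abs_sub_le_oscFn`), equal in law along the increment
  process and along the path (`measure_oscFn_incr_eq`), with the tail of `BrownianRunningSup`.

## References

* G. F. Lawler, O. Schramm, W. Werner, *Conformal restriction: the chordal case* (2003), §5
  [LawlerSchrammWerner2003Restriction].
-/

noncomputable section

open Set Filter Metric Function MeasureTheory ProbabilityTheory
open _root_.Complex _root_.Topology
open Literature.Probability.Process (brownian preWienerMeasure runSup dyadTime dyadTime_le measure_runSup_ge_le)
open scoped NNReal

namespace Literature.Probability.RandomPlanarGeometry

open Loewner PathOps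

/-! ### An elementary power inequality -/

/-- `|x^{5/8} - y^{5/8}| ≤ |x - y|^{5/8}` for `x, y ≥ 0` (subadditivity of `t ↦ t^{5/8}`).
[folklore] -/
theorem abs_rpow_sub_rpow_le {x y : ℝ} (hx : 0 ≤ x) (hy : 0 ≤ y) :
    |x ^ (5 / 8 : ℝ) - y ^ (5 / 8 : ℝ)| ≤ |x - y| ^ (5 / 8 : ℝ) := by
  -- reduce to `y ≤ x`
  wlog hxy : y ≤ x generalizing x y
  · have := this hy hx (le_of_not_ge hxy)
    rwa [abs_sub_comm, abs_sub_comm y x] at this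
  have hsub : x ^ (5 / 8 : ℝ) ≤ (x - y) ^ (5 / 8 : ℝ) + y ^ (5 / 8 : ℝ) := by
    have h := NNReal.rpow_add_le_add_rpow (x - y).toNNReal y.toNNReal (by norm_num : (0 : ℝ) ≤ 5 / 8) (by norm_num)
    have h' := NNReal.coe_le_coe.2 h
    rw [NNReal.coe_rpow, NNReal.coe_add, NNReal.coe_add, NNReal.coe_rpow, NNReal.coe_rpow,
      Real.coe_toNNReal _ (sub_nonneg.2 hxy), Real.coe_toNNReal _ hy, sub_add_cancel] at h'
    exact h'
  have hmono : y ^ (5 / 8 : ℝ) ≤ x ^ (5 / 8 : ℝ) := Real.rpow_le_rpow hy hxy (by norm_num)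
  rw [abs_of_nonneg (sub_nonneg.2 hmono), abs_of_nonneg (sub_nonneg.2 hxy)]
  linarith

/-! ### The controlled class up to and including `Tₙ` -/

section Controlled

variable {A : Set ℂ} {hA : IsStarHull A} {hne : A.Nonempty} {n : ℕ} {ω : ℝ≥0 → ℝ}

/-- **Up to and including `Tₙ > 0`** the path is alive, `R ≥ cₙ`, `D̂ⁿ⁺¹ = Φ' ≥ cₙ` and
`dist(0, A_t - W_t) ≥ cₙ` (the strict bounds before `Tₙ` pass to `Tₙ` by continuity). [folklore] -/
theorem controlled_of_le_locTime {t : ℝ≥0} (ht : (t : WithTop ℝ≥0) ≤ locTime hA hne n ω)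
    (hT0 : (0 : WithTop ℝ≥0) < locTime hA hne n ω) :
    Disjoint (closedHull (drv (brownianCPath ω)) t) A ∧ locLevel n ≤ Rp hA hne t ω ∧
      Dhatp hA hne (n + 1) t ω = starDeriv (slidHull (drv (brownianCPath ω)) A t) ∧
      locLevel n ≤ starDeriv (slidHull (drv (brownianCPath ω)) A t) ∧
      locLevel n ≤ infDist 0 (slidHull (drv (brownianCPath ω)) A t) := by
  -- `R_t ≥ c` and `D̂_t ≥ c`
  have hRD : locLevel n ≤ Rp hA hne t ω ∧ locLevel n ≤ Dhatp hA hne (n + 1) t ω := by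
    rcases ht.lt_or_eq with hlt | heq
    · obtain ⟨-, hR, hDeq, hd, -⟩ := controlled_of_lt_locTime hlt
      exact ⟨hR.le, by rw [hDeq]; exact hd.le⟩
    · -- `t = Tₙ > 0`: limits from the left
      have ht0 : 0 < t := by
        have : (0 : WithTop ℝ≥0) < t := by rw [heq]; exact hT0
        exact_mod_cast this
      haveI : (𝓝[<] t).NeBot := nhdsLT_neBot_of_exists_lt ⟨0, ht0⟩  -- may need a different name
      have hev : ∀ᶠ r in 𝓝[<] t, locLevel n < Rp hA hne r ω ∧ locLevel n < Dhatp hA hne (n + 1) r ω := by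
        filter_upwards [self_mem_nhdsWithin] with r hr
        have hr' : (r : WithTop ℝ≥0) < locTime hA hne n ω := by rw [← heq]; exact_mod_cast hr
        obtain ⟨-, hR, hDeq, hd, -⟩ := controlled_of_lt_locTime hr'
        exact ⟨hR, by rw [hDeq]; exact hd⟩
      obtain ⟨hRc, hDc⟩ := continuous_Rp_Dhatp (hA := hA) (hne := hne) (n + 1) ω
      constructor
      · exact ge_of_tendsto (hRc.continuousAt.tendsto.mono_left nhdsWithin_le_nhds) (hev.mono fun r hr ↦ hr.1.le)
      · exact ge_of_tendsto (hDc.continuousAt.tendsto.mono_left nhdsWithin_le_nhds) (hev.mono fun r hr ↦ hr.2.le)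
  obtain ⟨hR, hD⟩ := hRD
  have hR' : 1 / ((n + 1 : ℕ) : ℝ) ≤ RFn hA hne t (brownianCPath ω) := by
    rw [Nat.cast_add, Nat.cast_one]; exact hR
  obtain ⟨halive, hDeq⟩ := DhatFn_eq_starDeriv (hA := hA) (hne := hne) (Nat.succ_pos n) hR'
  refine ⟨halive, hR, hDeq, by rw [← hDeq]; exact hD, ?_⟩
  have hsp := denseSeq_spec hA hne
  have := aliveFn_le_min_infDist (W := fun υ : C(ℝ≥0, ℝ) ↦ drv υ) (continuous_drv _) hA hsp.1 hsp.2 le_rfl halive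
  exact hR.trans (this.trans (min_le_left _ _))

end Controlled

/-! ### The pathwise cell estimate -/

section Cell

variable {A : Set ℂ} {hA : IsStarHull A} {hne : A.Nonempty} {n : ℕ} {ω : ℝ≥0 → ℝ} {u h : ℝ≥0} {S : ℝ}
  (hu : (u : WithTop ℝ≥0) < locTime hA hne n ω) (hh0 : 0 < h)
  (hS : ∀ r : ℝ≥0, r ≤ h → |drv (brownianCPath ω) (u + r) - drv (brownianCPath ω) u| ≤ S)
  (hsmall : stepSize S h ≤ locLevel n * (locLevel n / 16) / 1000)
  (hh4 : (h : ℝ) ≤ (locLevel n / 16 / 4) ^ 2)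

/-- The size of the one-step derivative error over the cell: `Δ = 50h/ρ₀² + 2(S + 4√h)/ρ₀`,
`ρ₀ = cₙ/16`. [folklore] -/
def cellErr (n : ℕ) (S : ℝ) (h : ℝ≥0) : ℝ := 50 * h / (locLevel n / 16) ^ 2 + 2 * stepSize S h / (locLevel n / 16)

include hu hS hsmall hh4 in
/-- **One-step control from the base time `u < Tₙ`**: for `0 < u' ≤ h`, the path is alive at
`u + u'` and `|Φ'_{A_{u+u'} - W_{u+u'}}(0) - Φ'_{A_u - W_u}(0)| ≤ Δ`. [folklore] -/
theorem abs_starDeriv_add_sub_le {u' : ℝ≥0} (hu'0 : 0 < u') (hu'h : u' ≤ h) :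
    Disjoint (closedHull (drv (brownianCPath ω)) (u + u')) A ∧
      |starDeriv (slidHull (drv (brownianCPath ω)) A (u + u')) - starDeriv (slidHull (drv (brownianCPath ω)) A u)| ≤
        cellErr n S h := by
  obtain ⟨hc0, hc1⟩ := locLevel_pos_le n
  set c := locLevel n with hc
  set ρ₀ : ℝ := c / 16 with hρ
  have hρ₀ : 0 < ρ₀ := by positivity
  set W := drv (brownianCPath ω) with hW
  have hWc : Continuous W := continuous_drv _
  obtain ⟨halive, -, -, hd, hm⟩ := controlled_of_lt_locTime hu
  set B := slidHull W A u with hB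
  have hBstar : IsStarHull B := isStarHull_slidHull_of_disjoint hWc hA halive
  have hBρ : Disjoint (ball (0 : ℂ) (8 * ρ₀)) B := by
    rw [Set.disjoint_left]
    intro z hz hzB
    have h1 := infDist_le_dist_of_mem (x := (0 : ℂ)) hzB
    rw [dist_comm, dist_zero_right] at h1
    have h2 : ‖z‖ < 8 * ρ₀ := mem_ball_zero_iff.1 hz
    have : 8 * ρ₀ = c / 2 := by rw [hρ]; ring
    linarith
  -- the shifted driver
  set U : ℝ≥0 → ℝ := fun r ↦ W (u + r) - W u with hU
  have hUc : Continuous U := (continuous_shift W hWc u).sub continuous_const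
  have hU0 : U 0 = 0 := by simp [hU]
  have hS0 : 0 ≤ S := (abs_nonneg _).trans (hS 0 bot_le)
  have hS' : ∀ v : ℝ≥0, v ≤ u' → |U v| ≤ S := fun v hv ↦ hS v (hv.trans hu'h)
  have hstep_mono : stepSize S u' ≤ stepSize S h := by
    rw [stepSize, stepSize]
    have := Real.sqrt_le_sqrt (show (u' : ℝ) ≤ h by exact_mod_cast hu'h)
    linarith
  have hη1 : stepSize S u' ≤ starDeriv B * ρ₀ / 1000 := by
    refine hstep_mono.trans (hsmall.trans ?_)
    have := mul_le_mul_of_nonneg_right hd.le hρ₀.le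
    rw [div_le_div_iff_of_pos_right (by norm_num : (0:ℝ) < 1000)]
    exact this
  have hηρ : stepSize S u' ≤ ρ₀ := by
    refine hη1.trans ?_
    have hd1 := (starDeriv_pos_le_one B).2
    have : starDeriv B * ρ₀ ≤ 1 * ρ₀ := mul_le_mul_of_nonneg_right hd1 hρ₀.le
    rw [div_le_iff₀ (by norm_num : (0:ℝ) < 1000)]; nlinarith
  have hh4' : (u' : ℝ) ≤ (ρ₀ / 4) ^ 2 := (show (u' : ℝ) ≤ h by exact_mod_cast hu'h).trans hh4
  have hSu : ∀ r : ℝ≥0, r ≤ u' → |W (u + r) - W u| ≤ S := fun r hr ↦ hS r (hr.trans hu'h)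
  refine ⟨disjoint_closedHull_add hWc hA halive hρ₀ hBρ hu'0 hSu hηρ hh4', ?_⟩
  rw [slidHull_add_eq hWc hA halive hρ₀ hBρ hu'0 hSu hηρ hh4']
  have key := abs_starDeriv_slidHull_sub_le hBstar hUc hU0 hu'0 hS' hρ₀ hBρ hη1
  refine key.trans ?_
  have hce : cellErr n S h = 50 * h / ρ₀ ^ 2 + 2 * stepSize S h / ρ₀ := by rw [cellErr]
  rw [hce]
  have h1 : 50 * (u' : ℝ) / ρ₀ ^ 2 ≤ 50 * h / ρ₀ ^ 2 := by
    gcongr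
  have h2 : 2 * stepSize S u' / ρ₀ ≤ 2 * stepSize S h / ρ₀ := by gcongr
  linarith

include hu hh0 hS hsmall hh4 in
/-- **The boundary-cell estimate**: with `Ỹ = (D̂ⁿ⁺¹)^{5/8}` and `Ŷ_{u+h} = (Φ' 𝟙{alive})_{u+h}^{5/8}`,
`|Ỹ_{(u+h) ∧ Tₙ} - Ŷ_{u+h}| ≤ (2Δ)^{5/8}` (and `= 0` when `Tₙ ≥ u + h`).
[cite: LawlerSchrammWerner2003Restriction, §5] -/
theorem abs_stopped_sub_DFn_rpow_le :
    |stoppedProcess (fun t ω ↦ Dhatp hA hne (n + 1) t ω ^ (5 / 8 : ℝ)) (locTime hA hne n) (u + h) ω -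
        DFn A (u + h) (brownianCPath ω) ^ (5 / 8 : ℝ)| ≤ (2 * cellErr n S h) ^ (5 / 8 : ℝ) := by
  have hT0 : (0 : WithTop ℝ≥0) < locTime hA hne n ω := lt_of_le_of_lt bot_le hu
  obtain ⟨haliveh, hdh⟩ := abs_starDeriv_add_sub_le hu hS hsmall hh4 hh0 le_rfl
  have hDFn : DFn A (u + h) (brownianCPath ω) = starDeriv (slidHull (drv (brownianCPath ω)) A (u + h)) :=
    (DFn_eq (A := A) (u + h) (brownianCPath ω)).1 haliveh
  rw [stoppedProcess, hDFn]
  rcases le_or_gt ((u + h : ℝ≥0) : WithTop ℝ≥0) (locTime hA hne n ω) with hle | hlt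
  · -- `Tₙ ≥ u + h`: no boundary
    rw [min_eq_left hle, Process.untopA_coe]
    obtain ⟨-, -, hDeq, -, -⟩ := controlled_of_le_locTime hle hT0
    rw [hDeq, sub_self, abs_zero]
    exact Real.rpow_nonneg (by have := (abs_nonneg _).trans hdh; linarith) _
  · -- `u < Tₙ = τ < u + h`
    obtain ⟨τ, hτ⟩ := WithTop.ne_top_iff_exists.1 (ne_top_of_lt hlt)
    have hτ' : locTime hA hne n ω = τ := hτ.symm
    have huτ : u < τ := by have : (u : WithTop ℝ≥0) < τ := by rw [hτ]; exact hu
                           exact_mod_cast this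
    have hτh : τ < u + h := by have : (τ : WithTop ℝ≥0) < (u + h : ℝ≥0) := by rw [hτ]; exact hlt
                               exact_mod_cast this
    rw [hτ', min_eq_right (WithTop.coe_le_coe.2 hτh.le), Process.untopA_coe]
    obtain ⟨-, -, hDeq, -, -⟩ := controlled_of_le_locTime (t := τ) (by rw [hτ']) hT0
    rw [hDeq]
    -- both derivatives are within `Δ` of the base one
    have hu' : 0 < τ - u := tsub_pos_of_lt huτ
    have hu'h : τ - u ≤ h := by
      rw [tsub_le_iff_right, add_comm]; exact hτh.le
    obtain ⟨-, hdτ⟩ := abs_starDeriv_add_sub_le hu hS hsmall hh4 hu' hu'h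
    rw [add_tsub_cancel_of_le huτ.le] at hdτ
    have h0τ := (starDeriv_pos_le_one (slidHull (drv (brownianCPath ω)) A τ)).1.le
    have h0h := (starDeriv_pos_le_one (slidHull (drv (brownianCPath ω)) A (u + h))).1.le
    refine (abs_rpow_sub_rpow_le h0τ h0h).trans (Real.rpow_le_rpow (abs_nonneg _) ?_ (by norm_num))
    rw [abs_sub_comm] at hdh
    calc |starDeriv (slidHull (drv (brownianCPath ω)) A τ) - starDeriv (slidHull (drv (brownianCPath ω)) A (u + h))|
        ≤ |starDeriv (slidHull (drv (brownianCPath ω)) A τ) - starDeriv (slidHull (drv (brownianCPath ω)) A u)| +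
          |starDeriv (slidHull (drv (brownianCPath ω)) A u) - starDeriv (slidHull (drv (brownianCPath ω)) A (u + h))| :=
          abs_sub_le _ _ _
      _ ≤ cellErr n S h + cellErr n S h := add_le_add hdτ hdh
      _ = 2 * cellErr n S h := by ring

end Cell

/-! ### The oscillation functional -/

section Osc

/-- **The dyadic oscillation functional** `osc_h(υ) = sup_{dyadic q ≤ h} |υ(q) - υ(0)|`. [folklore] -/
def oscFn (h : ℝ≥0) (υ : C(ℝ≥0, ℝ)) : ℝ := ⨆ p : ℕ × ℕ, |υ (dyadTime h p.1 p.2) - υ 0|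

/-- The family is bounded above (continuous path on `[0, h]`). [folklore] -/
theorem bddAbove_range_oscFn (h : ℝ≥0) (υ : C(ℝ≥0, ℝ)) :
    BddAbove (Set.range fun p : ℕ × ℕ ↦ |υ (dyadTime h p.1 p.2) - υ 0|) := by
  obtain ⟨C, hC⟩ := isCompact_Icc.exists_bound_of_continuousOn (s := Set.Icc (0 : ℝ≥0) h)
    ((υ.continuous.sub continuous_const).continuousOn (s := Set.Icc (0 : ℝ≥0) h))
  refine ⟨C, ?_⟩
  rintro _ ⟨p, rfl⟩
  have := hC (dyadTime h p.1 p.2) ⟨bot_le, dyadTime_le h p.1 p.2⟩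
  rwa [Real.norm_eq_abs] at this

/-- Grid values are `≤ oscFn`. [folklore] -/
theorem abs_sub_dyad_le_oscFn (h : ℝ≥0) (υ : C(ℝ≥0, ℝ)) (m k : ℕ) :
    |υ (dyadTime h m k) - υ 0| ≤ oscFn h υ :=
  le_ciSup (bddAbove_range_oscFn h υ) (m, k)

/-- **`|υ(s) - υ(0)| ≤ osc_h(υ)` for `s ≤ h`** (grid points approximate `s`; the path is continuous).
[folklore] -/
theorem abs_sub_le_oscFn {h s : ℝ≥0} (hs : s ≤ h) (υ : C(ℝ≥0, ℝ)) : |υ s - υ 0| ≤ oscFn h υ := by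
  have hgrid := abs_sub_dyad_le_oscFn h υ
  rcases eq_or_ne h 0 with rfl | h0
  · have : s = 0 := le_antisymm hs bot_le
    subst this
    have := hgrid 0 0
    simp only [dyadTime, Nat.cast_zero, zero_div, mul_zero] at this
    simpa using this
  have hpos : (0 : ℝ) < h := lt_of_le_of_ne h.coe_nonneg (fun h' ↦ h0 (by exact_mod_cast h'.symm))
  set k : ℕ → ℕ := fun n ↦ ⌊(s : ℝ) / h * 2 ^ n⌋₊ with hk
  have hbounds : ∀ n, (dyadTime h n (k n) : ℝ) ≤ s ∧ (s : ℝ) - h / 2 ^ n ≤ dyadTime h n (k n) := by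
    intro n
    have hfl := Nat.floor_le (by positivity : (0 : ℝ) ≤ (s : ℝ) / h * 2 ^ n)
    have hfl' : (s : ℝ) / h * 2 ^ n < k n + 1 := Nat.lt_floor_add_one _
    have hval : ((h * ((k n : ℝ≥0) / 2 ^ n) : ℝ≥0) : ℝ) = h * (k n : ℝ) / 2 ^ n := by push_cast; ring
    have hle : ((h * ((k n : ℝ≥0) / 2 ^ n) : ℝ≥0) : ℝ) ≤ s := by
      rw [hval, div_le_iff₀ (by positivity)]
      calc (h : ℝ) * (k n) ≤ h * ((s : ℝ) / h * 2 ^ n) := mul_le_mul_of_nonneg_left hfl h.coe_nonneg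
        _ = s * 2 ^ n := by field_simp
    have hmin : dyadTime h n (k n) = h * ((k n : ℝ≥0) / 2 ^ n) := by
      rw [dyadTime, min_eq_left]
      exact_mod_cast hle.trans (by exact_mod_cast hs : (s : ℝ) ≤ h)
    refine ⟨by rw [hmin]; exact hle, ?_⟩
    rw [hmin, hval, le_div_iff₀ (by positivity)]
    rw [div_mul_eq_mul_div, div_lt_iff₀ hpos] at hfl'
    have h2n : (0 : ℝ) < 2 ^ n := by positivity
    have : ((s : ℝ) - h / 2 ^ n) * 2 ^ n = s * 2 ^ n - h := by field_simp
    rw [this]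
    nlinarith
  have hconv : Tendsto (fun n ↦ (dyadTime h n (k n) : ℝ)) atTop (𝓝 s) := by
    refine tendsto_of_tendsto_of_tendsto_of_le_of_le ?_ tendsto_const_nhds (fun n ↦ (hbounds n).2)
      (fun n ↦ (hbounds n).1)
    have h1 : Tendsto (fun n : ℕ ↦ (h : ℝ) / 2 ^ n) atTop (𝓝 0) := by
      have := (tendsto_pow_atTop_nhds_zero_of_lt_one (r := (1 / 2 : ℝ)) (by norm_num) (by norm_num)).const_mul (h : ℝ)
      rw [mul_zero] at this
      refine this.congr fun n ↦ ?_
      rw [one_div, inv_pow, div_eq_mul_inv]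
    simpa using tendsto_const_nhds.sub h1
  have hconv' : Tendsto (fun n ↦ dyadTime h n (k n)) atTop (𝓝 s) := NNReal.tendsto_coe.1 hconv
  have hcont : Tendsto (fun n ↦ |υ (dyadTime h n (k n)) - υ 0|) atTop (𝓝 |υ s - υ 0|) :=
    (((υ.continuous.tendsto s).comp hconv').sub tendsto_const_nhds).abs
  exact le_of_tendsto' hcont fun n ↦ hgrid n (k n)

/-- Along the Brownian path `oscFn` is the running supremum of `BrownianRunningSup`. [folklore] -/
theorem oscFn_brownianCPath (h : ℝ≥0) (ω : ℝ≥0 → ℝ) : oscFn h (brownianCPath ω) = runSup h ω := by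
  rw [oscFn, runSup]
  congr 1; funext p
  rw [brownianCPath_apply, brownianCPath_apply, Process.brownian_zero]
  simp

/-- **The oscillation of the increments after `u` is dominated by `oscFn` of the increment path.**
[folklore] -/
theorem abs_incr_le_oscFn {h r : ℝ≥0} (hr : r ≤ h) (u : ℝ≥0) (υ : C(ℝ≥0, ℝ)) :
    |υ (u + r) - υ u| ≤ oscFn h (incr u υ) := by
  have := abs_sub_le_oscFn hr (incr u υ)
  simpa [incr_apply] using this

variable [MeasurableSpace C(ℝ≥0, ℝ)] [BorelSpace C(ℝ≥0, ℝ)]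

/-- `oscFn h` is measurable. [folklore] -/
theorem measurable_oscFn (h : ℝ≥0) : Measurable (oscFn h) :=
  Measurable.iSup fun _ ↦ ((PathOps.measurable_eval _).sub (PathOps.measurable_eval 0)).abs

/-- **The oscillation after `u` has the law of the running supremum**:
`P(a ≤ osc_h(incr_u β)) = P(a ≤ runSup h)`. [folklore] -/
theorem measure_oscFn_incr_eq (h u : ℝ≥0) (a : ℝ) :
    preWienerMeasure {ω | a ≤ oscFn h (incr u (brownianCPath ω))} = preWienerMeasure {ω | a ≤ runSup h ω} := by
  have hS : MeasurableSet {υ : C(ℝ≥0, ℝ) | a ≤ oscFn h υ} := measurableSet_le measurable_const (measurable_oscFn h)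
  have := (identDistrib_incr u).measure_mem_eq hS
  simp only [preimage_setOf_eq, oscFn_brownianCPath] at this
  exact this

/-- **Tail of the oscillation**: for `0 < a` and `h ≤ (a/2)²/2`,
`P(a ≤ osc_h(incr_u β)) ≤ 128 h²/a⁴`. [folklore] -/
theorem measureReal_oscFn_incr_ge_le (h u : ℝ≥0) {a : ℝ} (ha : 0 < a) (hh : (h : ℝ) ≤ (a / 2) ^ 2 / 2) :
    preWienerMeasure.real {ω | a ≤ oscFn h (incr u (brownianCPath ω))} ≤ 128 * (h : ℝ) ^ 2 / a ^ 4 := by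
  rw [measureReal_def, measure_oscFn_incr_eq]
  have ha2 : 0 < (a / 2) ^ 2 := by positivity
  have hlt : (h : ℝ) < (a / 2) ^ 2 := by linarith
  have h1 := measure_runSup_ge_le h ha.le hlt
  have hden : (a / 2) ^ 2 / 2 ≤ (a / 2) ^ 2 - h := by linarith
  have hbound : 2 * (h : ℝ) ^ 2 / ((a / 2) ^ 2 - h) ^ 2 ≤ 128 * (h : ℝ) ^ 2 / a ^ 4 := by
    calc 2 * (h : ℝ) ^ 2 / ((a / 2) ^ 2 - h) ^ 2 ≤ 2 * (h : ℝ) ^ 2 / ((a / 2) ^ 2 / 2) ^ 2 := by gcongr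
      _ = 128 * (h : ℝ) ^ 2 / a ^ 4 := by field_simp; ring
  calc (preWienerMeasure {ω | a ≤ runSup h ω}).toReal ≤ (ENNReal.ofReal (2 * (h : ℝ) ^ 2 / ((a / 2) ^ 2 - h) ^ 2)).toReal :=
        ENNReal.toReal_mono ENNReal.ofReal_ne_top h1
    _ = 2 * (h : ℝ) ^ 2 / ((a / 2) ^ 2 - h) ^ 2 := ENNReal.toReal_ofReal (by positivity)
    _ ≤ 128 * (h : ℝ) ^ 2 / a ^ 4 := hbound

end Osc

end Literature.Probability.RandomPlanarGeometry
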